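import Literature.NumberTheory.DiophantineGeometry.SUnitMordellHeightBoundsModularityProofs
import HarnessLib

/-!
# von Känel–Matschke, Prop. 10.2: the first display from the second one for `N_S ≥ 53` (proofs)

Topic `Literature/NumberTheory/DiophantineGeometry` (family `abc`, LADDER-ABC A1: the *modular method*).
Theorems only — NO new statement (D-0026). von Känel–Matschke, arXiv:1605.06079 = Mem. AMS **286**
(2023) no. 1419 [`VonkanelMatschke2023`], Prop. 10.2 (`prop:su`, §10.1.2) has two displays,
`max(h(x), h(y)) ≤ (5/2) N_S log N_S + 9 N_S` and
`max(h(x), h(y)) ≤ (12/5) N_S log N_S + (9/10) N_S log log log(16 N_S) + 8.26 N_S + 28`, and §10.4 says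
"Proposition 10.6 implies Proposition 10.2". The second display follows from Prop. 10.6 for every `S`
(`sUnitEquation_height_le_two_of_abc_log_max_le_refined`); the first does NOT follow formally for the
eleven square-free even values `N_S ≤ 46` listed in `SUnitMordellHeightBoundsModularityProofs.lean`. This
file proves the complementary positive statement:

* `second_display_le_first_display` — for real `N ≥ 53`:
  `(12/5) N log N + (9/10) N log₃(16N) + 8.26 N + 28 ≤ (5/2) N log N + 9N` (with `log 7 ≤ 1.95`,
  `log t ≤ log t₀ + t/t₀ − 1`, `log N ≥ 5 log 2`).
* `sUnitEquation_height_le_one_of_abc_log_max_le_refined` — **Prop. 10.6 ⟹ the FIRST display of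
  Prop. 10.2 for all `S` with `N_S ≥ 53`** (so for every square-free even `N_S ≥ 58`, i.e. for all `S`
  except the eleven sets of the finding), and `abc_log_max_le_refined_imp_sUnitEquation_height_le_of_le` —
  both displays, i.e. the conclusion of `sUnitEquation_height_le`, for `N_S ≥ 53`.

No `abc` claim; typed ≠ proved: Prop. 10.6 remains a named fact.

## References

* [VonkanelMatschke2023] R. von Känel, B. Matschke, arXiv:1605.06079 = Mem. AMS 286 (2023), Prop. 10.2
  (§10.1.2) and §10.4 (proof of Prop. 10.2).
-/

noncomputable section

open Height

namespace Literature.NumberTheory.DiophantineGeometry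

namespace VonKanelMatschke

/-- `log 7 ≤ 1.95` (`7 ≤ Σ_{i<9} 1.95^i/i! ≤ e^{1.95}`). [folklore] -/
private theorem log_seven_le : Real.log 7 ≤ 1.95 := by
  rw [Real.log_le_iff_le_exp (by norm_num)]
  have h2 : (7 : ℝ) ≤ ∑ i ∈ Finset.range 9, (1.95 : ℝ) ^ i / (i.factorial : ℝ) := by
    simp only [Finset.sum_range_succ, Finset.sum_range_zero, Nat.factorial]
    norm_num
  exact h2.trans (Real.sum_le_exp_of_nonneg (by norm_num) 9)

/-- **The second display of Prop. 10.2 is below the first one once `N_S ≥ 53`**: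
`(12/5) N log N + (9/10) N log log log(16N) + 8.26 N + 28 ≤ (5/2) N log N + 9 N` for real `N ≥ 53`
(tangent bounds `log log(16N) ≤ log 7 + log(16N)/7 − 1`, `log₃(16N) ≤ log 2 + (log log 16N)/2 − 1`,
and `log N ≥ 5 log 2`). [cite: VonkanelMatschke2023, Prop. 10.2 (the two displays)] -/
theorem second_display_le_first_display {N : ℝ} (hN : 53 ≤ N) :
    12 / 5 * N * Real.log N + 9 / 10 * N * Real.log (Real.log (Real.log (16 * N))) + 8.26 * N + 28 ≤
      5 / 2 * N * Real.log N + 9 * N := by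
  have hl2 := Real.log_two_lt_d9
  have hl2' := Real.log_two_gt_d9
  have hl7 := log_seven_le
  have hN0 : 0 < N := by linarith
  -- `L1 = log(16N) = 4 log 2 + log N ≥ 9 log 2`
  have hlogN : 5 * Real.log 2 ≤ Real.log N := by
    have h := Real.log_le_log (by norm_num) (show (32 : ℝ) ≤ N by linarith)
    rw [show (32 : ℝ) = 2 ^ 5 by norm_num, Real.log_pow] at h
    push_cast at h
    linarith
  have hL1 : Real.log (16 * N) = 4 * Real.log 2 + Real.log N := by
    rw [Real.log_mul (by norm_num) hN0.ne', show (16 : ℝ) = 2 ^ 4 by norm_num, Real.log_pow]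
    push_cast; ring
  have hL1pos : 1 < Real.log (16 * N) := by rw [hL1]; linarith
  -- `L2 = log L1 ≤ log 7 + L1/7 − 1`, `L2 > 0`
  have hL2 : Real.log (Real.log (16 * N)) ≤ Real.log 7 + (Real.log (16 * N) / 7 - 1) := by
    have e1 : Real.log (Real.log (16 * N)) = Real.log 7 + Real.log (Real.log (16 * N) / 7) := by
      rw [← Real.log_mul (by norm_num) (by positivity)]; congr 1; field_simp
    have e2 : Real.log (Real.log (16 * N) / 7) ≤ Real.log (16 * N) / 7 - 1 :=
      Real.log_le_sub_one_of_pos (by positivity)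
    linarith
  have hL2pos : 0 < Real.log (Real.log (16 * N)) := Real.log_pos hL1pos
  -- `L3 = log L2 ≤ log 2 + L2/2 − 1`
  have hL3 : Real.log (Real.log (Real.log (16 * N))) ≤
      Real.log 2 + (Real.log (Real.log (16 * N)) / 2 - 1) := by
    have e1 : Real.log (Real.log (Real.log (16 * N))) =
        Real.log 2 + Real.log (Real.log (Real.log (16 * N)) / 2) := by
      rw [← Real.log_mul (by norm_num) (by positivity)]; congr 1; field_simp
    have e2 : Real.log (Real.log (Real.log (16 * N)) / 2) ≤ Real.log (Real.log (16 * N)) / 2 - 1 :=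
      Real.log_le_sub_one_of_pos (by positivity)
    linarith
  -- multiply by `N ≥ 0` and conclude
  have h1 : N * Real.log (Real.log (Real.log (16 * N))) ≤
      N * (Real.log 2 + ((Real.log 7 + ((4 * Real.log 2 + Real.log N) / 7 - 1)) / 2 - 1)) := by
    apply mul_le_mul_of_nonneg_left _ hN0.le
    rw [← hL1]
    linarith
  have h2 : N * (5 * Real.log 2) ≤ N * Real.log N := mul_le_mul_of_nonneg_left hlogN hN0.le
  nlinarith

/-- **vKM Prop. 10.6 ⟹ Prop. 10.2, FIRST display, for `N_S ≥ 53`** (PROVED): from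
`abc_log_max_le_refined`, every solution of the `S`-unit equation with `N_S ≥ 53` satisfies
`max(h(x), h(y)) ≤ (5/2) N_S log N_S + 9 N_S` (the second display, PROVED from Prop. 10.6 for all `S`,
is below the first one from `N_S ≥ 53` on; the eleven square-free even `N_S ≤ 46` are exactly the sets
where this implication is not formal). [cite: VonkanelMatschke2023, Prop. 10.2 (first display) with §10.4] -/
theorem sUnitEquation_height_le_one_of_abc_log_max_le_refined (h : abc_log_max_le_refined)
    (S : Finset ℕ) (hS : ∀ p ∈ S, p.Prime) (hN : 53 ≤ primesProd S) (x y : ℚ) (hx : IsSUnit S x)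
    (hy : IsSUnit S y) (hxy : x + y = 1) :
    max (logHeight₁ x) (logHeight₁ y) ≤
      5 / 2 * (primesProd S : ℝ) * Real.log (primesProd S) + 9 * (primesProd S : ℝ) := by
  have h2 := sUnitEquation_height_le_two_of_abc_log_max_le_refined h S hS x y hx hy hxy
  have hN' : (53 : ℝ) ≤ primesProd S := by exact_mod_cast hN
  exact h2.trans (second_display_le_first_display hN')

/-- **Both displays of Prop. 10.2 from Prop. 10.6 for `N_S ≥ 53`** (PROVED): the conclusion of the named
fact `sUnitEquation_height_le`, restricted to `N_S ≥ 53`, follows from `abc_log_max_le_refined`.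
[cite: VonkanelMatschke2023, Prop. 10.2 with §10.4 ("Proposition 10.6 implies Proposition 10.2")] -/
theorem abc_log_max_le_refined_imp_sUnitEquation_height_le_of_le (h : abc_log_max_le_refined)
    (S : Finset ℕ) (hS : ∀ p ∈ S, p.Prime) (hN : 53 ≤ primesProd S) (x y : ℚ) (hx : IsSUnit S x)
    (hy : IsSUnit S y) (hxy : x + y = 1) :
    max (logHeight₁ x) (logHeight₁ y) ≤
        5 / 2 * (primesProd S : ℝ) * Real.log (primesProd S) + 9 * (primesProd S : ℝ) ∧
    max (logHeight₁ x) (logHeight₁ y) ≤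
        12 / 5 * (primesProd S : ℝ) * Real.log (primesProd S) +
          9 / 10 * (primesProd S : ℝ) * Real.log (Real.log (Real.log (16 * (primesProd S : ℝ)))) +
          8.26 * (primesProd S : ℝ) + 28 :=
  ⟨sUnitEquation_height_le_one_of_abc_log_max_le_refined h S hS hN x y hx hy hxy,
    sUnitEquation_height_le_two_of_abc_log_max_le_refined h S hS x y hx hy hxy⟩

end VonKanelMatschke

end Literature.NumberTheory.DiophantineGeometry

end
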